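import Literature.Probability.Percolation.FourArmGarbanOrthogonality
import Literature.Probability.Percolation.FourArmGarbanCircuitBits
import HarnessLib

/-!
# Events read off the whole interface: Garban's (B.7) `E[X C_j] = E[X C_j Y_j]`

Topic `Literature/Probability/Percolation`; support file for the named fact
`Garban2011_fourArm_multiscale` (`FourArmGarban.lean`; C. Garban, Appendix B of O. Schramm,
S. Smirnov, Ann. Probab. 39 (2011), Lemma B.1). Companion of `FourArmGarbanOrthogonality.lean`
(which treats the interface stopped at a first hitting time); here the interface is run to its
end.

Garban (proof of Lemma B.1): "Note also that, if `Q_j` is pivotal for `X`, then there are four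
alternating arms [...] which forces the interface `γ` to intersect `Q_j`, and `Y_j` to occur.
Therefore, similarly as for the estimate (B.5) above, one can check that (B.7)
`E[X C_j] = E[X C_j Y_j]`." The mechanism is that `X` (the crossing of `Q`) is read off the
interface, so that on `{Y_j = 0}` — the interface never meets `Q_j` — the pair `(X, Y_j)` is
determined by explored edges off `Q_j`, independent of the bit `C_j`, which has mean zero.
This file proves it for the tree's medial exploration:

* `IsInterfaceEvent hD W` — `W` is a union of full interface classes (prefix events
  `explorationCylinder hD ω₀ (exitTime hD ω₀)`); the revealment events `Reveals hD E`, their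
  complements and intersections are interface events;
* `pathAtom` — the atoms (full interface classes inside `W`), prefix events determined by the
  explored edges, which avoid `E` when `W ⊆ (Reveals hD E)ᶜ`;
* `measure_interfaceEvent_inter` — **`P(W ∩ X) = P(W) · P(X)`** for an interface event
  `W ⊆ (Reveals hD E)ᶜ` and an event `X` determined by pairs `F` whose domain edges lie in `E`;
* `integral_sign_mul_bit_indicator_compl_reveals_eq_zero` — **(B.7)**: for `X = 2·1_T - 1` with
  `T` an interface event and a bit `C = 1_O - 1_Δ` (events determined by such an `F`, equal
  probabilities), `∫ X · C · 1_{(Reveals hD E)ᶜ} = 0`, i.e. `E[X C] = E[X C Y]`.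

## References

* O. Schramm, S. Smirnov (appendix by C. Garban), Ann. Probab. 39 (2011), Appendix B, proof of
  Lemma B.1, (B.5) and (B.7) [SchrammSmirnov2011].
* H. Duminil-Copin, S. Smirnov, Clay Math. Proc. 15 (2012), §6.2 (prefix events of the
  exploration) [DuminilCopinSmirnov2012Clay].
-/

noncomputable section

namespace Literature.Probability.Percolation

open _root_.MeasureTheory Set LatticeModels LatticeModels.DiscreteDobrushin

variable {D : DiscreteDobrushin}

/-! ### Interface events -/

/-- **An event read off the whole interface**: with every configuration `ω₀ ∈ W`, the event
contains the full interface class of `ω₀` (the configurations whose exploration has the same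
corners up to the exit time). [cite: DuminilCopinSmirnov2012Clay, §6.2 (the exploration σ-algebra)] -/
def IsInterfaceEvent (hD : D.IsZdAdmissible) (W : Set (BondConfig (Site 2))) : Prop :=
  ∀ ω₀ ∈ W, explorationCylinder hD ω₀ (exitTime hD ω₀) ⊆ W

/-- On a full interface class the exit time is constant. [cite: DuminilCopinSmirnov2012Clay, §6.2, proof of Lemma 6.6] -/
theorem exitTime_eq_of_mem_fullCylinder {hD : D.IsZdAdmissible} {ω₀ ω : BondConfig (Site 2)}
    (h : ω ∈ explorationCylinder hD ω₀ (exitTime hD ω₀)) : exitTime hD ω = exitTime hD ω₀ := by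
  have := min_succ_exitTime_eq_of_mem_explorationCylinder h
  rw [Nat.min_eq_right (Nat.le_succ _)] at this
  omega

/-- On a full interface class the explored edges up to the exit time are constant.
[cite: DuminilCopinSmirnov2012Clay, §6.2, proof of Lemma 6.6] -/
theorem exploredEdge_eq_of_mem_fullCylinder {hD : D.IsZdAdmissible} {ω₀ ω : BondConfig (Site 2)}
    (h : ω ∈ explorationCylinder hD ω₀ (exitTime hD ω₀)) {i : ℕ} (hi : i ≤ exitTime hD ω₀) :
    exploredEdge hD ω i = exploredEdge hD ω₀ i :=
  exploredEdge_eq_of_mem_explorationCylinder h (by rw [min_self]; exact hi)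

/-- **Revealment events are interface events.** [folklore] -/
theorem isInterfaceEvent_reveals (hD : D.IsZdAdmissible) (E : Set (Sym2 (Site 2))) :
    IsInterfaceEvent hD (Reveals hD E) := by
  rintro ω₀ ⟨i, hi, hiE⟩ ω hω
  refine ⟨i, by rwa [exitTime_eq_of_mem_fullCylinder hω], ?_⟩
  rwa [exploredEdge_eq_of_mem_fullCylinder hω hi.le]

/-- The complement of an interface event is an interface event (the full classes partition the
configuration space). [folklore] -/
theorem IsInterfaceEvent.compl {hD : D.IsZdAdmissible} {W : Set (BondConfig (Site 2))}
    (hW : IsInterfaceEvent hD W) : IsInterfaceEvent hD Wᶜ := by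
  intro ω₀ hω₀ ω hω hωW
  apply hω₀
  -- `ω₀` lies in the full class of `ω`, which lies in `W`
  have hN := exitTime_eq_of_mem_fullCylinder hω
  have h' : ω₀ ∈ explorationCylinder hD ω (exitTime hD ω) := by
    rw [hN]; exact mem_explorationCylinder_comm hω
  exact hW ω hωW h'

/-- The intersection of interface events is an interface event. [folklore] -/
theorem IsInterfaceEvent.inter {hD : D.IsZdAdmissible} {W W' : Set (BondConfig (Site 2))}
    (hW : IsInterfaceEvent hD W) (hW' : IsInterfaceEvent hD W') : IsInterfaceEvent hD (W ∩ W') :=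
  fun ω₀ h => subset_inter (hW ω₀ h.1) (hW' ω₀ h.2)

/-- An interface event is read off the completed configuration. [folklore] -/
theorem IsInterfaceEvent.bcInvariant {hD : D.IsZdAdmissible} {W : Set (BondConfig (Site 2))}
    (hW : IsInterfaceEvent hD W) (ω ω' : BondConfig (Site 2)) (h : D.bcBondConfig ω = D.bcBondConfig ω') :
    ω ∈ W ↔ ω' ∈ W := by
  have key : ∀ ω ω' : BondConfig (Site 2), D.bcBondConfig ω = D.bcBondConfig ω' → ω ∈ W → ω' ∈ W := by
    intro ω ω' h hω
    refine hW ω hω fun i _ => ?_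
    rw [h]
  exact ⟨key ω ω' h, key ω' ω h.symm⟩

/-- Interface events are measurable. [folklore] -/
theorem IsInterfaceEvent.measurableSet {hD : D.IsZdAdmissible} {W : Set (BondConfig (Site 2))}
    (hW : IsInterfaceEvent hD W) : MeasurableSet W :=
  measurableSet_of_bcInvariant hD hW.bcInvariant

/-! ### The atoms: full interface classes -/

/-- **The full interface class with prescribed exit time and corners** inside `W`. [folklore] -/
def pathAtom (hD : D.IsZdAdmissible) (W : Set (BondConfig (Site 2))) (N : ℕ)
    (π : Fin (N + 1) → Site 2 × Fin 4) : Set (BondConfig (Site 2)) :=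
  {ω ∈ W | exitTime hD ω = N ∧
    ∀ i : Fin (N + 1), cornerOrbit (D.bcBondConfig ω) (startCorner hD) i = π i}

/-- `W` is the union of its atoms. [folklore] -/
theorem eq_iUnion_pathAtom (hD : D.IsZdAdmissible) (W : Set (BondConfig (Site 2))) :
    W = ⋃ q : Σ N : ℕ, (Fin (N + 1) → Site 2 × Fin 4), pathAtom hD W q.1 q.2 := by
  ext ω
  simp only [pathAtom, mem_iUnion, mem_setOf_eq]
  constructor
  · intro h
    exact ⟨⟨exitTime hD ω, fun i => cornerOrbit (D.bcBondConfig ω) (startCorner hD) i⟩, h, rfl,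
      fun _ => rfl⟩
  · rintro ⟨_, h, -, -⟩; exact h

/-- Distinct indices give disjoint atoms. [folklore] -/
theorem pairwise_disjoint_pathAtom (hD : D.IsZdAdmissible) (W : Set (BondConfig (Site 2))) :
    Pairwise (Function.onFun Disjoint fun q : Σ N : ℕ, (Fin (N + 1) → Site 2 × Fin 4) =>
      pathAtom hD W q.1 q.2) := by
  rintro ⟨N, π⟩ ⟨N', π'⟩ hne
  refine Set.disjoint_left.2 fun ω h h' => hne ?_
  obtain ⟨-, hN, hπ⟩ := h
  obtain ⟨-, hN', hπ'⟩ := h'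
  have hNN : N = N' := hN.symm.trans hN'
  subst hNN
  have : π = π' := funext fun i => (hπ i).symm.trans (hπ' i)
  subst this
  rfl

/-- **A nonempty atom of an interface event is a full prefix event.** [cite: DuminilCopinSmirnov2012Clay, §6.2, proof of Lemma 6.6] -/
theorem pathAtom_eq_explorationCylinder {hD : D.IsZdAdmissible} {W : Set (BondConfig (Site 2))}
    (hW : IsInterfaceEvent hD W) {N : ℕ} {π : Fin (N + 1) → Site 2 × Fin 4}
    {ω₀ : BondConfig (Site 2)} (h₀ : ω₀ ∈ pathAtom hD W N π) :
    pathAtom hD W N π = explorationCylinder hD ω₀ (exitTime hD ω₀) := by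
  obtain ⟨hW₀, hN₀, hπ₀⟩ := h₀
  ext ω
  constructor
  · rintro ⟨-, hN, hπ⟩
    rw [mem_explorationCylinder_iff]
    intro i hi
    rw [min_self, hN₀] at hi
    exact (hπ ⟨i, Nat.lt_succ_of_le hi⟩).trans (hπ₀ ⟨i, Nat.lt_succ_of_le hi⟩).symm
  · intro hω
    refine ⟨hW ω₀ hW₀ hω, (exitTime_eq_of_mem_fullCylinder hω).trans hN₀, fun i => ?_⟩
    have := (mem_explorationCylinder_iff.1 hω) i (by rw [min_self, hN₀]; exact Nat.le_of_lt_succ i.isLt)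
    rw [this]; exact hπ₀ i

/-- Atoms of interface events are measurable. [folklore] -/
theorem measurableSet_pathAtom {hD : D.IsZdAdmissible} {W : Set (BondConfig (Site 2))}
    (hW : IsInterfaceEvent hD W) (N : ℕ) (π : Fin (N + 1) → Site 2 × Fin 4) :
    MeasurableSet (pathAtom hD W N π) := by
  refine measurableSet_of_bcInvariant hD fun ω ω' h => ?_
  simp only [pathAtom, mem_setOf_eq, hW.bcInvariant ω ω' h, exitTime_congr hD h, h]

/-! ### Independence of interface events avoiding `E` from the events inside `E` -/

/-- **On an atom**: `P(W_atom ∩ X) = P(W_atom) · P(X)` for an interface event `W` on which the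
interface never meets `E`, and `X` determined by pairs `F` whose domain edges lie in `E`.
[cite: SchrammSmirnov2011, Appendix B, proof of Lemma B.1, (B.5)/(B.7)] -/
theorem measure_pathAtom_inter (hD : D.IsZdAdmissible) (p : unitInterval)
    {W : Set (BondConfig (Site 2))} (hW : IsInterfaceEvent hD W) {E F : Set (Sym2 (Site 2))}
    (hWE : W ⊆ (Reveals hD E)ᶜ)
    (hFE : ∀ e ∈ F, e ∈ (discreteDomainGraph D.Ω D.δ).edgeSet → e ∈ E)
    {X : Set (BondConfig (Site 2))} (hX : DeterminedBy X F) (hXm : MeasurableSet X)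
    (N : ℕ) (π : Fin (N + 1) → Site 2 × Fin 4) :
    bondPercolation (zdGraph 2) p (pathAtom hD W N π ∩ X) =
      bondPercolation (zdGraph 2) p (pathAtom hD W N π) * bondPercolation (zdGraph 2) p X := by
  rcases (pathAtom hD W N π).eq_empty_or_nonempty with h0 | ⟨ω₀, h₀⟩
  · simp [h0]
  · have hatom := pathAtom_eq_explorationCylinder hW h₀
    obtain ⟨hW₀, -, -⟩ := h₀
    set T : Set (Sym2 (Site 2)) := {e | ∃ i < min (exitTime hD ω₀) (exitTime hD ω₀),
      D.IsFreeEdge (exploredEdge hD ω₀ i) ∧ e = exploredEdge hD ω₀ i} with hTdef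
    have hT : DeterminedBy (pathAtom hD W N π) T := by
      rw [hatom]; exact determinedBy_explorationCylinder hD ω₀ _
    have hTF : Disjoint T F := by
      rw [Set.disjoint_left]
      rintro e ⟨i, hi, -, rfl⟩ heF
      rw [min_self] at hi
      exact hWE hW₀ ⟨i, hi, hFE _ heF (exploredEdge_mem_edgeSet hi)⟩
    have h := bondPercolation_inter_of_disjoint (zdGraph 2) p hTF hT hX
      (measurableSet_pathAtom hW N π) hXm
    exact h

/-- **Interface events avoiding `E` are independent of the events inside `E`**:
`P(W ∩ X) = P(W) · P(X)` (sum over the countably many atoms). [cite: SchrammSmirnov2011, Appendix B, proof of Lemma B.1, (B.5)/(B.7)] -/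
theorem measure_interfaceEvent_inter (hD : D.IsZdAdmissible) (p : unitInterval)
    {W : Set (BondConfig (Site 2))} (hW : IsInterfaceEvent hD W) {E F : Set (Sym2 (Site 2))}
    (hWE : W ⊆ (Reveals hD E)ᶜ)
    (hFE : ∀ e ∈ F, e ∈ (discreteDomainGraph D.Ω D.δ).edgeSet → e ∈ E)
    {X : Set (BondConfig (Site 2))} (hX : DeterminedBy X F) (hXm : MeasurableSet X) :
    bondPercolation (zdGraph 2) p (W ∩ X) =
      bondPercolation (zdGraph 2) p W * bondPercolation (zdGraph 2) p X := by
  set P := bondPercolation (zdGraph 2) p with hP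
  set f : (Σ N : ℕ, (Fin (N + 1) → Site 2 × Fin 4)) → Set (BondConfig (Site 2)) :=
    fun q => pathAtom hD W q.1 q.2 with hf
  have hunion : W = ⋃ q, f q := eq_iUnion_pathAtom hD W
  have hdisj : Pairwise (Function.onFun Disjoint f) := pairwise_disjoint_pathAtom hD W
  have hmeas : ∀ q, MeasurableSet (f q) := fun q => measurableSet_pathAtom hW q.1 q.2
  have hdisj' : Pairwise (Function.onFun Disjoint fun q => f q ∩ X) := fun q q' hne =>
    (hdisj hne).mono inter_subset_left inter_subset_left
  calc P (W ∩ X) = P (⋃ q, f q ∩ X) := by rw [hunion, iUnion_inter]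
    _ = ∑' q, P (f q ∩ X) := measure_iUnion hdisj' fun q => (hmeas q).inter hXm
    _ = ∑' q, P (f q) * P X := by
        congr 1; funext q
        exact measure_pathAtom_inter hD p hW hWE hFE hX hXm q.1 q.2
    _ = (∑' q, P (f q)) * P X := ENNReal.tsum_mul_right
    _ = P (⋃ q, f q) * P X := by rw [measure_iUnion hdisj hmeas]
    _ = P W * P X := by rw [← hunion]

/-- Real-valued form. [cite: SchrammSmirnov2011, Appendix B, proof of Lemma B.1, (B.5)/(B.7)] -/
theorem measureReal_interfaceEvent_inter (hD : D.IsZdAdmissible) (p : unitInterval)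
    {W : Set (BondConfig (Site 2))} (hW : IsInterfaceEvent hD W) {E F : Set (Sym2 (Site 2))}
    (hWE : W ⊆ (Reveals hD E)ᶜ)
    (hFE : ∀ e ∈ F, e ∈ (discreteDomainGraph D.Ω D.δ).edgeSet → e ∈ E)
    {X : Set (BondConfig (Site 2))} (hX : DeterminedBy X F) (hXm : MeasurableSet X) :
    (bondPercolation (zdGraph 2) p).real (W ∩ X) =
      (bondPercolation (zdGraph 2) p).real W * (bondPercolation (zdGraph 2) p).real X := by
  simp only [measureReal_def]
  rw [measure_interfaceEvent_inter hD p hW hWE hFE hX hXm, ENNReal.toReal_mul]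

/-! ### Garban's (B.7) -/

/-- The integrand of (B.7), expanded into indicators. [folklore] -/
theorem sign_mul_bit_mul_indicator (T O Δ V : Set (BondConfig (Site 2))) (ω : BondConfig (Site 2)) :
    (2 * T.indicator (1 : BondConfig (Site 2) → ℝ) ω - 1) *
        (O.indicator (1 : BondConfig (Site 2) → ℝ) ω - Δ.indicator 1 ω) * Vᶜ.indicator 1 ω =
      2 * (T ∩ Vᶜ ∩ O).indicator 1 ω - 2 * (T ∩ Vᶜ ∩ Δ).indicator 1 ω -
        (Vᶜ ∩ O).indicator 1 ω + (Vᶜ ∩ Δ).indicator 1 ω := by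
  by_cases hT : ω ∈ T <;> by_cases hO : ω ∈ O <;> by_cases hΔ : ω ∈ Δ <;>
    by_cases hV : ω ∈ V <;> norm_num [hT, hO, hΔ, hV]

/-- **Garban's (B.7) `E[X C_j] = E[X C_j Y_j]`**, in the form `E[X C_j (1 - Y_j)] = 0`: for
`X = 2·1_T - 1` with `T` an interface event (the crossing of `Q`, read off `γ`), a bit
`C = 1_O - 1_Δ` whose events are determined by pairs `F` with domain edges in `E` and have
equal probabilities (`E[C] = 0`), and `Y = 1_{Reveals hD E}`: on `{Y = 0}` the interface
never meets `E`, so `(X, Y)` is independent of `C`. [cite: SchrammSmirnov2011, Appendix B, proof of Lemma B.1, (B.7)] -/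
theorem integral_sign_mul_bit_indicator_compl_reveals_eq_zero (hD : D.IsZdAdmissible) (p : unitInterval)
    {T : Set (BondConfig (Site 2))} (hT : IsInterfaceEvent hD T) {E F : Set (Sym2 (Site 2))}
    (hFE : ∀ e ∈ F, e ∈ (discreteDomainGraph D.Ω D.δ).edgeSet → e ∈ E)
    {O Δ : Set (BondConfig (Site 2))} (hO : DeterminedBy O F) (hΔ : DeterminedBy Δ F)
    (hOm : MeasurableSet O) (hΔm : MeasurableSet Δ)
    (h : (bondPercolation (zdGraph 2) p).real O = (bondPercolation (zdGraph 2) p).real Δ) :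
    ∫ ω, (2 * T.indicator (1 : BondConfig (Site 2) → ℝ) ω - 1) *
        (O.indicator (1 : BondConfig (Site 2) → ℝ) ω - Δ.indicator 1 ω) *
        (Reveals hD E)ᶜ.indicator 1 ω ∂(bondPercolation (zdGraph 2) p) = 0 := by
  set P := bondPercolation (zdGraph 2) p with hP
  set V := Reveals hD E with hV
  have hVc : IsInterfaceEvent hD Vᶜ := (isInterfaceEvent_reveals hD E).compl
  have hTV : IsInterfaceEvent hD (T ∩ Vᶜ) := hT.inter hVc
  have hVcm : MeasurableSet Vᶜ := hVc.measurableSet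
  have hTVm : MeasurableSet (T ∩ Vᶜ) := hTV.measurableSet
  simp_rw [sign_mul_bit_mul_indicator]
  have hI : ∀ {W X : Set (BondConfig (Site 2))}, MeasurableSet W → MeasurableSet X →
      Integrable ((W ∩ X).indicator (1 : BondConfig (Site 2) → ℝ)) P := fun hW hX =>
    (integrable_const (1 : ℝ)).indicator (hW.inter hX)
  have hE : ∀ {W X : Set (BondConfig (Site 2))}, MeasurableSet W → MeasurableSet X →
      ∫ ω, (W ∩ X).indicator (1 : BondConfig (Site 2) → ℝ) ω ∂P = P.real (W ∩ X) := fun hW hX =>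
    integral_indicator_one (hW.inter hX)
  change ∫ ω, ((2 : ℝ) • (T ∩ Vᶜ ∩ O).indicator (1 : BondConfig (Site 2) → ℝ) -
      (2 : ℝ) • (T ∩ Vᶜ ∩ Δ).indicator (1 : BondConfig (Site 2) → ℝ) -
      (Vᶜ ∩ O).indicator (1 : BondConfig (Site 2) → ℝ) +
      (Vᶜ ∩ Δ).indicator (1 : BondConfig (Site 2) → ℝ) : BondConfig (Site 2) → ℝ) ω ∂P = 0
  rw [integral_add' ((((hI hTVm hOm).smul 2).sub ((hI hTVm hΔm).smul 2)).sub (hI hVcm hOm))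
      (hI hVcm hΔm),
    integral_sub' (((hI hTVm hOm).smul 2).sub ((hI hTVm hΔm).smul 2)) (hI hVcm hOm),
    integral_sub' ((hI hTVm hOm).smul 2) ((hI hTVm hΔm).smul 2)]
  simp only [Pi.smul_apply, smul_eq_mul, integral_const_mul]
  rw [hE hTVm hOm, hE hTVm hΔm, hE hVcm hOm, hE hVcm hΔm,
    measureReal_interfaceEvent_inter hD p hTV inter_subset_right hFE hO hOm,
    measureReal_interfaceEvent_inter hD p hTV inter_subset_right hFE hΔ hΔm,
    measureReal_interfaceEvent_inter hD p hVc subset_rfl hFE hO hOm,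
    measureReal_interfaceEvent_inter hD p hVc subset_rfl hFE hΔ hΔm, h]
  ring

end Literature.Probability.Percolation
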